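import Summits.Ventures.CertifiedArithmetic.LowPrec.PatternBands

/-!
# The per-band error tables in ULPS and in ABSOLUTE UNITS as a proved algorithm

Venture: CertifiedArithmetic (T1-LOWPREC-ENVELOPES). HONEST FRAMING: certified error envelopes and
provably optimal rounding/accumulation schemes for low-precision formats under stated cost models;
every table by two implementations; no hardware or vendor claims.

`PatternBands.lean` proves the RELATIVE column of the per-band tables (THEOREMS-R1 Remark E5′,
`code/enum/bandconst.py`) on the normal bands. This file does the same for the other two columns
of those tables on the normal bands — the maximum error in ULPS of the exact result and the
maximum ABSOLUTE error — from the same placed-pattern lists: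

* in band `β` of destination `R` (`2^(m+β) · q ≤ |t| < 2^(m+β+1) · q`, `q = quantum_R`) the unit
  in the last place of the exact result is `2^β · q`, and a placed pattern `(N, E)` with
  `2^m ≤ N` has `patShift R F N + E = β` (`Format.patShift_add_eq_of_band`), so that
  `|t| = (N / 2^patShift) · (2^β · q)` (`Format.abs_eq_ulp_mul_of_band`); hence the error in ulps
  of a pattern is `ulpOf err R F N = err R F N · N / 2^patShift` — a function of `N` ALONE;
* `envconstMulBandUlpNE/TZ/Dir`, `envconstAddBandUlpNE/TZ/Dir X Y R β` = the maximum of `ulpOf`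
  over the realisable patterns placed in band `β` (the lists `mulBandErrs` / `addBandErrs` of
  `PatternBands.lean` with `err := ulpOf err`);
* SOUND and ATTAINED for every rounding with a pattern bridge whose pattern error vanishes on
  short significands (`N < 2^m`: such values are representable; true for the four roundings,
  `Format.patRelErrNE/TZ/Dir_eq_zero_of_lt`): `MiniFloat.mul_bandUlp_le`, `mul_bandUlp_attained`,
  `add_bandUlp_le`, `add_bandUlp_attained` bound `|fl t - t|` by `c · (2^β · quantum_R)` on the band
  and produce data in the band with equality. Read with the factor `2^β · quantum_R` this IS the
  absolute column (`max abs = max ulp · 2^β · quantum_R`, same maximiser); the four roundings are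
  the corollaries `MiniFloat.mul/add_ulpNE/TZ/RD/RU_band_le`.

Instances (FP6/FP4 keys) follow in `PatternBandsUlpMulFP6FP4.lean` / `PatternBandsUlpAddFP6FP4.lean`.
Documented exclusions: subnormal bands; FP8 keys are not instantiated.
-/

namespace Literature.ComputerArithmetic.FloatingPoint

open Format

/-- `maxList0 l ≥ 0`. [folklore] -/
theorem maxList0_nonneg (l : List ℚ) : 0 ≤ maxList0 l := by
  induction l with
  | nil => exact le_rfl
  | cons a l ih => exact le_trans ih (le_max_right _ _)

namespace Format

variable {R : Format}

/-- ERROR IN ULPS OF A PATTERN: the relative pattern error times `N / 2^patShift` (the value of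
the pattern in ulps of its own binade). [folklore] -/
def ulpOf (err : Format → ℕ → ℕ → ℚ) (R : Format) (F N : ℕ) : ℚ :=
  err R F N * N / 2 ^ R.patShift F N

/-- `ulpOf err ≥ 0` for a nonnegative `err`. [folklore] -/
theorem ulpOf_nonneg {err : Format → ℕ → ℕ → ℚ} {F : ℕ} (h : ∀ N, 0 ≤ err R F N) (N : ℕ) :
    0 ≤ ulpOf err R F N :=
  div_nonneg (mul_nonneg (h N) (Nat.cast_nonneg _)) (by positivity)

/-- Short significands (`N < 2^m`, representable values) have nearest pattern error `0`.
[folklore] -/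
theorem patRelErrNE_eq_zero_of_lt {F N : ℕ} (h : N < 2 ^ R.manBits) : R.patRelErrNE F N = 0 := by
  have hs := patShift_eq_zero_of_lt (F := F)
    (lt_of_lt_of_le h (Nat.pow_le_pow_right (by norm_num) (Nat.le_succ _)))
  simp [patRelErrNE, hs, Nat.mod_one]

/-- Short significands have toward-zero pattern error `0`. [folklore] -/
theorem patRelErrTZ_eq_zero_of_lt {F N : ℕ} (h : N < 2 ^ R.manBits) : R.patRelErrTZ F N = 0 := by
  have hs := patShift_eq_zero_of_lt (F := F)
    (lt_of_lt_of_le h (Nat.pow_le_pow_right (by norm_num) (Nat.le_succ _)))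
  simp [patRelErrTZ, hs, Nat.mod_one]

/-- Short significands have directed pattern error `0`. [folklore] -/
theorem patRelErrDir_eq_zero_of_lt {F N : ℕ} (h : N < 2 ^ R.manBits) :
    R.patRelErrDir F N = 0 := by
  have hs := patShift_eq_zero_of_lt (F := F)
    (lt_of_lt_of_le h (Nat.pow_le_pow_right (by norm_num) (Nat.le_succ _)))
  simp [patRelErrDir, patRelErrTZ, patRelErrAW, hs, Nat.mod_one]

/-- BAND PLACEMENT FIXES THE EXPONENT: a pattern `(N, E)` with `2^m ≤ N` placed in band `β` has
`patShift R F N + E = β`. [folklore] -/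
theorem patShift_add_eq_of_band {F N β : ℕ} {E : ℤ} (hm : 2 ^ R.manBits ≤ N)
    (hF : N < 2 ^ (R.manBits + 1 + F)) (hb : R.bandB β N E = true) :
    (R.patShift F N : ℤ) + E = β := by
  have h1 := pow_patShift_le (R := R) (F := F) hm
  have h2 := lt_pow_patShift_succ (R := R) hF
  cases E with
  | ofNat e =>
    simp only [bandB, decide_eq_true_eq] at hb
    obtain ⟨hb1, hb2, -⟩ := hb
    have h3 : 2 ^ (R.manBits + R.patShift F N + e) < 2 ^ (R.manBits + β + 1) := by
      rw [pow_add]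
      exact lt_of_le_of_lt (Nat.mul_le_mul_right _ h1) hb2
    have h4 : 2 ^ (R.manBits + β) < 2 ^ (R.manBits + R.patShift F N + 1 + e) := by
      rw [pow_add _ (R.manBits + R.patShift F N + 1) e]
      exact lt_of_le_of_lt hb1 (Nat.mul_lt_mul_of_pos_right h2 (by positivity))
    have h3' := (Nat.pow_lt_pow_iff_right (by norm_num)).mp h3
    have h4' := (Nat.pow_lt_pow_iff_right (by norm_num)).mp h4
    simp only [Int.ofNat_eq_natCast]
    omega
  | negSucc e =>
    simp only [bandB, decide_eq_true_eq] at hb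
    obtain ⟨hb1, hb2, -⟩ := hb
    have h3 : 2 ^ (R.manBits + β + (e + 1)) < 2 ^ (R.manBits + R.patShift F N + 1) := by
      rw [pow_add]
      exact lt_of_le_of_lt hb1 h2
    have h4 : 2 ^ (R.manBits + R.patShift F N) < 2 ^ (R.manBits + β + 1 + (e + 1)) := by
      rw [pow_add _ (R.manBits + β + 1) (e + 1)]
      exact lt_of_le_of_lt h1 hb2
    have h3' := (Nat.pow_lt_pow_iff_right (by norm_num)).mp h3
    have h4' := (Nat.pow_lt_pow_iff_right (by norm_num)).mp h4
    rw [Int.negSucc_eq]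
    omega

/-- IN ULPS OF THE BAND: a value of pattern `(N, E)`, `2^m ≤ N`, placed in band `β` has magnitude
`(N / 2^patShift) · (2^β · quantum_R)`. [folklore] -/
theorem abs_eq_ulp_mul_of_band {t : ℚ} {F N β : ℕ} {E : ℤ} (hm : 2 ^ R.manBits ≤ N)
    (hF : N < 2 ^ (R.manBits + 1 + F)) (ht : |t| = (N : ℚ) * 2 ^ E * R.quantum)
    (hb : R.bandB β N E = true) :
    |t| = (N : ℚ) / 2 ^ R.patShift F N * (2 ^ β * R.quantum) := by
  have hE : E = (β : ℤ) - R.patShift F N := by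
    have h := patShift_add_eq_of_band hm hF hb
    omega
  rw [ht, hE, zpow_sub₀ (by norm_num : (2 : ℚ) ≠ 0), zpow_natCast, zpow_natCast]
  ring

end Format

/-! ### The constants -/

/-- BAND CONSTANT IN ULPS, products, nearest. [folklore] -/
def envconstMulBandUlpNE (X Y R : Format) (β : ℕ) : ℚ :=
  maxList0 (mulBandErrs (ulpOf patRelErrNE) X Y R β)

/-- BAND CONSTANT IN ULPS, products, toward zero. [folklore] -/
def envconstMulBandUlpTZ (X Y R : Format) (β : ℕ) : ℚ :=
  maxList0 (mulBandErrs (ulpOf patRelErrTZ) X Y R β)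

/-- BAND CONSTANT IN ULPS, products, round down / round up. [folklore] -/
def envconstMulBandUlpDir (X Y R : Format) (β : ℕ) : ℚ :=
  maxList0 (mulBandErrs (ulpOf patRelErrDir) X Y R β)

/-- BAND CONSTANT IN ULPS, sums, nearest. [folklore] -/
def envconstAddBandUlpNE (X Y R : Format) (β : ℕ) : ℚ :=
  maxList0 (addBandErrs (ulpOf patRelErrNE) X Y R β)

/-- BAND CONSTANT IN ULPS, sums, toward zero. [folklore] -/
def envconstAddBandUlpTZ (X Y R : Format) (β : ℕ) : ℚ :=
  maxList0 (addBandErrs (ulpOf patRelErrTZ) X Y R β)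

/-- BAND CONSTANT IN ULPS, sums, round down / round up. [folklore] -/
def envconstAddBandUlpDir (X Y R : Format) (β : ℕ) : ℚ :=
  maxList0 (addBandErrs (ulpOf patRelErrDir) X Y R β)

namespace MiniFloat

variable {X Y : Format}

/-! ### Products -/

/-- SOUNDNESS PER BAND IN ULPS (products): for a rounding with a pattern bridge whose error
vanishes on short significands, every product of data in band `β` is off by at most
`maxList0 (mulBandErrs (ulpOf err) X Y R β)` ulps of the band, `2^β · quantum_R`. [folklore] -/
theorem mul_bandUlp_le (R : Format) (B : PatBridge R (mulFuel X Y))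
    (herr0 : ∀ N, N < 2 ^ R.manBits → B.err R (mulFuel X Y) N = 0) (β : ℕ) (a : MiniFloat X)
    (b : MiniFloat Y) (h1 : 2 ^ (R.manBits + β) * R.quantum ≤ |a.toRat * b.toRat|)
    (h2 : |a.toRat * b.toRat| < 2 ^ (R.manBits + β + 1) * R.quantum)
    (h3 : |a.toRat * b.toRat| ≤ R.maxRat) :
    |(B.fl (a.toRat * b.toRat)).toRat - a.toRat * b.toRat|
      ≤ maxList0 (mulBandErrs (ulpOf B.err) X Y R β) * (2 ^ β * R.quantum) := by
  have hlo := normal_of_band h1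
  have hpos : 0 < |a.toRat * b.toRat| := abs_pos.mpr (ne_zero_of_normal hlo)
  have hF := mul_lt_pow_mulFuel R a.sig_lt b.sig_lt
  have ht := abs_mul_toRat_eq R a b
  have hbnd := abs_sub_le_mul_of_relErr_le hpos (B.rel_le _ _ _ hF ht hlo h3)
  have hu : 0 ≤ (2 : ℚ) ^ β * R.quantum := (mul_pos (by positivity) R.quantum_pos).le
  rcases Nat.lt_or_ge (a.sig * b.sig) (2 ^ R.manBits) with hsm | hbig
  · rw [herr0 _ hsm, zero_mul] at hbnd
    exact le_trans hbnd (mul_nonneg (maxList0_nonneg _) hu)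
  · have hb := (bandB_iff_of_eq ht).mpr ⟨h1, h2, h3⟩
    have hmem := le_maxList0_of_mem (mem_mulBandErrs_of_band (ulpOf B.err) R a b h1 h2 h3)
    calc |(B.fl (a.toRat * b.toRat)).toRat - a.toRat * b.toRat|
        ≤ B.err R (mulFuel X Y) (a.sig * b.sig) * |a.toRat * b.toRat| := hbnd
      _ = ulpOf B.err R (mulFuel X Y) (a.sig * b.sig) * (2 ^ β * R.quantum) := by
          rw [abs_eq_ulp_mul_of_band hbig hF ht hb, ulpOf]; ring
      _ ≤ _ := mul_le_mul_of_nonneg_right hmem hu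

/-- ATTAINMENT PER BAND IN ULPS (products). [folklore] -/
theorem mul_bandUlp_attained (R : Format) (B : PatBridge R (mulFuel X Y))
    (herr0 : ∀ N, N < 2 ^ R.manBits → B.err R (mulFuel X Y) N = 0) (β : ℕ)
    (hne : mulBandErrs (ulpOf B.err) X Y R β ≠ []) :
    ∃ (a : MiniFloat X) (b : MiniFloat Y),
      2 ^ (R.manBits + β) * R.quantum ≤ |a.toRat * b.toRat| ∧
      |a.toRat * b.toRat| < 2 ^ (R.manBits + β + 1) * R.quantum ∧ |a.toRat * b.toRat| ≤ R.maxRat ∧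
      |(B.fl (a.toRat * b.toRat)).toRat - a.toRat * b.toRat|
        = maxList0 (mulBandErrs (ulpOf B.err) X Y R β) * (2 ^ β * R.quantum) := by
  have hmem := maxList0_mem_of_ne_nil hne (fun c hc => by
    obtain ⟨k₁, j₁, k₂, j₂, -, -, -, rfl⟩ := mem_mulBandErrs.mp hc
    exact ulpOf_nonneg B.err_nonneg _)
  obtain ⟨k₁, j₁, k₂, j₂, hk1, hk2, hp, hc⟩ := mem_mulBandErrs.mp hmem
  have hN : 0 < k₁ * k₂ := by
    rcases Nat.eq_zero_or_pos (k₁ * k₂) with h0 | h0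
    · have h := (bandB_eq_true_iff.mp hp).1
      rw [h0, Nat.cast_zero, zero_mul] at h
      exact absurd h (not_le.mpr (by positivity))
    · exact h0
  obtain ⟨a, b, ht, hsgn⟩ := exists_data_of_mem_sigShifts R hk1 hk2
    (Nat.pos_of_ne_zero fun h0 => by rw [h0, zero_mul] at hN; exact lt_irrefl 0 hN)
    (Nat.pos_of_ne_zero fun h0 => by rw [h0, mul_zero] at hN; exact lt_irrefl 0 hN)
    (B.sgn (k₁ * k₂))
  have hband := (bandB_iff_of_eq ht).mp hp
  have hlo := normal_of_band hband.1
  have hne0 := ne_zero_of_normal hlo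
  have hF := mul_lt_pow_mulFuel R (mem_sigShifts.mp hk1).1 (mem_sigShifts.mp hk2).1
  have heq := abs_sub_eq_mul_of_relErr_eq (abs_pos.mpr hne0)
    (B.rel_eq _ _ _ hne0 hsgn hF ht hlo hband.2.2)
  refine ⟨a, b, hband.1, hband.2.1, hband.2.2, ?_⟩
  rw [hc, heq]
  rcases Nat.lt_or_ge (k₁ * k₂) (2 ^ R.manBits) with hsm | hbig
  · rw [ulpOf, herr0 _ hsm]; simp
  · rw [abs_eq_ulp_mul_of_band hbig hF ht hp, ulpOf]; ring

/-! ### Sums -/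

/-- SOUNDNESS PER BAND IN ULPS (sums). [folklore] -/
theorem add_bandUlp_le (R : Format) (B : PatBridge R (addFuel X Y))
    (herr0 : ∀ N, N < 2 ^ R.manBits → B.err R (addFuel X Y) N = 0) (β : ℕ) (a : MiniFloat X)
    (b : MiniFloat Y) (h1 : 2 ^ (R.manBits + β) * R.quantum ≤ |a.toRat + b.toRat|)
    (h2 : |a.toRat + b.toRat| < 2 ^ (R.manBits + β + 1) * R.quantum)
    (h3 : |a.toRat + b.toRat| ≤ R.maxRat) :
    |(B.fl (a.toRat + b.toRat)).toRat - (a.toRat + b.toRat)|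
      ≤ maxList0 (addBandErrs (ulpOf B.err) X Y R β) * (2 ^ β * R.quantum) := by
  have hlo := normal_of_band h1
  have hpos : 0 < |a.toRat + b.toRat| := abs_pos.mpr (ne_zero_of_normal hlo)
  have hF := addPatN_lt_pow R a.mem_sigShiftsC b.mem_sigShiftsC (xor a.neg b.neg)
  have ht := abs_add_toRat_eq R a b
  have hbnd := abs_sub_le_mul_of_relErr_le hpos (B.rel_le _ _ _ hF ht hlo h3)
  have hu : 0 ≤ (2 : ℚ) ^ β * R.quantum := (mul_pos (by positivity) R.quantum_pos).le
  rcases Nat.lt_or_ge (addPatN a.sig ((a.bshift : ℤ) + expOffset X R) b.sig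
      ((b.bshift : ℤ) + expOffset Y R) (xor a.neg b.neg)) (2 ^ R.manBits) with hsm | hbig
  · rw [herr0 _ hsm, zero_mul] at hbnd
    exact le_trans hbnd (mul_nonneg (maxList0_nonneg _) hu)
  · have hb := (bandB_iff_of_eq ht).mpr ⟨h1, h2, h3⟩
    have hmem := le_maxList0_of_mem (mem_addBandErrs_of_band (ulpOf B.err) R a b h1 h2 h3)
    calc |(B.fl (a.toRat + b.toRat)).toRat - (a.toRat + b.toRat)|
        ≤ B.err R (addFuel X Y) _ * |a.toRat + b.toRat| := hbnd
      _ = ulpOf B.err R (addFuel X Y) _ * (2 ^ β * R.quantum) := by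
          rw [abs_eq_ulp_mul_of_band hbig hF ht hb, ulpOf]; ring
      _ ≤ _ := mul_le_mul_of_nonneg_right hmem hu

/-- ATTAINMENT PER BAND IN ULPS (sums). [folklore] -/
theorem add_bandUlp_attained (R : Format) (B : PatBridge R (addFuel X Y))
    (herr0 : ∀ N, N < 2 ^ R.manBits → B.err R (addFuel X Y) N = 0) (β : ℕ)
    (hne : addBandErrs (ulpOf B.err) X Y R β ≠ []) :
    ∃ (a : MiniFloat X) (b : MiniFloat Y),
      2 ^ (R.manBits + β) * R.quantum ≤ |a.toRat + b.toRat| ∧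
      |a.toRat + b.toRat| < 2 ^ (R.manBits + β + 1) * R.quantum ∧ |a.toRat + b.toRat| ≤ R.maxRat ∧
      |(B.fl (a.toRat + b.toRat)).toRat - (a.toRat + b.toRat)|
        = maxList0 (addBandErrs (ulpOf B.err) X Y R β) * (2 ^ β * R.quantum) := by
  have hmem := maxList0_mem_of_ne_nil hne (fun c hc => by
    obtain ⟨k₁, j₁, k₂, j₂, opp, -, -, -, rfl⟩ := mem_addBandErrs.mp hc
    exact ulpOf_nonneg B.err_nonneg _)
  obtain ⟨k₁, j₁, k₂, j₂, opp, hk1, hk2, hp, hc⟩ := mem_addBandErrs.mp hmem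
  have hN : addPatN k₁ ((j₁ : ℤ) + expOffset X R) k₂ ((j₂ : ℤ) + expOffset Y R) opp ≠ 0 := by
    intro h0
    have h := (bandB_eq_true_iff.mp hp).1
    rw [h0, Nat.cast_zero, zero_mul] at h
    exact absurd h (not_le.mpr (by positivity))
  obtain ⟨a, b, ht, hsgn⟩ := exists_data_add R hk1 hk2 opp (B.sgn _) hN
  have hband := (bandB_iff_of_eq ht).mp hp
  have hlo := normal_of_band hband.1
  have hne0 := ne_zero_of_normal hlo
  have hF := addPatN_lt_pow R hk1 hk2 opp
  have heq := abs_sub_eq_mul_of_relErr_eq (abs_pos.mpr hne0)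
    (B.rel_eq _ _ _ hne0 hsgn hF ht hlo hband.2.2)
  refine ⟨a, b, hband.1, hband.2.1, hband.2.2, ?_⟩
  rw [hc, heq]
  rcases Nat.lt_or_ge (addPatN k₁ ((j₁ : ℤ) + expOffset X R) k₂ ((j₂ : ℤ) + expOffset Y R) opp)
      (2 ^ R.manBits) with hsm | hbig
  · rw [ulpOf, herr0 _ hsm]; simp
  · rw [abs_eq_ulp_mul_of_band hbig hF ht hp, ulpOf]; ring

/-! ### The four roundings -/

/-- Products, nearest, in ulps of the band. [folklore] -/
theorem mul_ulpNE_band_le (R : Format) (β : ℕ) (a : MiniFloat X) (b : MiniFloat Y)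
    (h1 : 2 ^ (R.manBits + β) * R.quantum ≤ |a.toRat * b.toRat|)
    (h2 : |a.toRat * b.toRat| < 2 ^ (R.manBits + β + 1) * R.quantum)
    (h3 : |a.toRat * b.toRat| ≤ R.maxRat) :
    |(roundNE R (a.toRat * b.toRat)).toRat - a.toRat * b.toRat|
      ≤ envconstMulBandUlpNE X Y R β * (2 ^ β * R.quantum) :=
  mul_bandUlp_le R (bridgeNE R _) (fun _ h => patRelErrNE_eq_zero_of_lt h) β a b h1 h2 h3

/-- Products, toward zero, in ulps of the band. [folklore] -/
theorem mul_ulpTZ_band_le (R : Format) (β : ℕ) (a : MiniFloat X) (b : MiniFloat Y)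
    (h1 : 2 ^ (R.manBits + β) * R.quantum ≤ |a.toRat * b.toRat|)
    (h2 : |a.toRat * b.toRat| < 2 ^ (R.manBits + β + 1) * R.quantum)
    (h3 : |a.toRat * b.toRat| ≤ R.maxRat) :
    |(roundTowardZero R (a.toRat * b.toRat)).toRat - a.toRat * b.toRat|
      ≤ envconstMulBandUlpTZ X Y R β * (2 ^ β * R.quantum) :=
  mul_bandUlp_le R (bridgeTZ R _) (fun _ h => patRelErrTZ_eq_zero_of_lt h) β a b h1 h2 h3

/-- Products, round down, in ulps of the band. [folklore] -/
theorem mul_ulpRD_band_le (R : Format) (β : ℕ) (a : MiniFloat X) (b : MiniFloat Y)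
    (h1 : 2 ^ (R.manBits + β) * R.quantum ≤ |a.toRat * b.toRat|)
    (h2 : |a.toRat * b.toRat| < 2 ^ (R.manBits + β + 1) * R.quantum)
    (h3 : |a.toRat * b.toRat| ≤ R.maxRat) :
    |(roundDown R (a.toRat * b.toRat)).toRat - a.toRat * b.toRat|
      ≤ envconstMulBandUlpDir X Y R β * (2 ^ β * R.quantum) :=
  mul_bandUlp_le R (bridgeRD R _) (fun _ h => patRelErrDir_eq_zero_of_lt h) β a b h1 h2 h3

/-- Products, round up, in ulps of the band. [folklore] -/
theorem mul_ulpRU_band_le (R : Format) (β : ℕ) (a : MiniFloat X) (b : MiniFloat Y)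
    (h1 : 2 ^ (R.manBits + β) * R.quantum ≤ |a.toRat * b.toRat|)
    (h2 : |a.toRat * b.toRat| < 2 ^ (R.manBits + β + 1) * R.quantum)
    (h3 : |a.toRat * b.toRat| ≤ R.maxRat) :
    |(roundUp R (a.toRat * b.toRat)).toRat - a.toRat * b.toRat|
      ≤ envconstMulBandUlpDir X Y R β * (2 ^ β * R.quantum) :=
  mul_bandUlp_le R (bridgeRU R _) (fun _ h => patRelErrDir_eq_zero_of_lt h) β a b h1 h2 h3

/-- Sums, nearest, in ulps of the band. [folklore] -/
theorem add_ulpNE_band_le (R : Format) (β : ℕ) (a : MiniFloat X) (b : MiniFloat Y)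
    (h1 : 2 ^ (R.manBits + β) * R.quantum ≤ |a.toRat + b.toRat|)
    (h2 : |a.toRat + b.toRat| < 2 ^ (R.manBits + β + 1) * R.quantum)
    (h3 : |a.toRat + b.toRat| ≤ R.maxRat) :
    |(roundNE R (a.toRat + b.toRat)).toRat - (a.toRat + b.toRat)|
      ≤ envconstAddBandUlpNE X Y R β * (2 ^ β * R.quantum) :=
  add_bandUlp_le R (bridgeNE R _) (fun _ h => patRelErrNE_eq_zero_of_lt h) β a b h1 h2 h3

/-- Sums, toward zero, in ulps of the band. [folklore] -/
theorem add_ulpTZ_band_le (R : Format) (β : ℕ) (a : MiniFloat X) (b : MiniFloat Y)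
    (h1 : 2 ^ (R.manBits + β) * R.quantum ≤ |a.toRat + b.toRat|)
    (h2 : |a.toRat + b.toRat| < 2 ^ (R.manBits + β + 1) * R.quantum)
    (h3 : |a.toRat + b.toRat| ≤ R.maxRat) :
    |(roundTowardZero R (a.toRat + b.toRat)).toRat - (a.toRat + b.toRat)|
      ≤ envconstAddBandUlpTZ X Y R β * (2 ^ β * R.quantum) :=
  add_bandUlp_le R (bridgeTZ R _) (fun _ h => patRelErrTZ_eq_zero_of_lt h) β a b h1 h2 h3

/-- Sums, round down, in ulps of the band. [folklore] -/
theorem add_ulpRD_band_le (R : Format) (β : ℕ) (a : MiniFloat X) (b : MiniFloat Y)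
    (h1 : 2 ^ (R.manBits + β) * R.quantum ≤ |a.toRat + b.toRat|)
    (h2 : |a.toRat + b.toRat| < 2 ^ (R.manBits + β + 1) * R.quantum)
    (h3 : |a.toRat + b.toRat| ≤ R.maxRat) :
    |(roundDown R (a.toRat + b.toRat)).toRat - (a.toRat + b.toRat)|
      ≤ envconstAddBandUlpDir X Y R β * (2 ^ β * R.quantum) :=
  add_bandUlp_le R (bridgeRD R _) (fun _ h => patRelErrDir_eq_zero_of_lt h) β a b h1 h2 h3

/-- Sums, round up, in ulps of the band. [folklore] -/
theorem add_ulpRU_band_le (R : Format) (β : ℕ) (a : MiniFloat X) (b : MiniFloat Y)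
    (h1 : 2 ^ (R.manBits + β) * R.quantum ≤ |a.toRat + b.toRat|)
    (h2 : |a.toRat + b.toRat| < 2 ^ (R.manBits + β + 1) * R.quantum)
    (h3 : |a.toRat + b.toRat| ≤ R.maxRat) :
    |(roundUp R (a.toRat + b.toRat)).toRat - (a.toRat + b.toRat)|
      ≤ envconstAddBandUlpDir X Y R β * (2 ^ β * R.quantum) :=
  add_bandUlp_le R (bridgeRU R _) (fun _ h => patRelErrDir_eq_zero_of_lt h) β a b h1 h2 h3

end MiniFloat

end Literature.ComputerArithmetic.FloatingPoint
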